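import Mathlib
import Summits.ResolutionOfSingularities.ResolutionOfSingularities.Theorems.WeightedInvariantLocalWeightedDropMonicDescentBridgeSlices
import Summits.ResolutionOfSingularities.ResolutionOfSingularities.Theorems.WeightedInvariantLocalWeightedDropMonicDescentSliceIdentifyTwo
import Summits.ResolutionOfSingularities.ResolutionOfSingularities.Theorems.WeightedInvariantLocalWeightedDropMonicDescentBridgeTools

/-!
# `WeightedInvariant.LocalWeightedDrop`, sub-stub `stub_monicDoublePointDescends`, piece T-6′ (game bridge), part 2:
# THE POINT SLICES AT `(c₀ : c₁)` (`y′₀ = 0`) AND AT `(0 : c₁)` ARE RE-PRESENTED BY THE TRANSPORTED LABELS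

Crux item stmt-ResolutionOfSingularities-8899 `LocalWeightedDrop` (route `ResolutionOfSingularities/WeightedInvariant`), door
`HypersurfaceCentreConstruction` stmt-ResolutionOfSingularities-19897.  [OURS · L1 W4.3, chain w43, seat res-type-056 (T-6′ per SEAT TABLE v6);
tools for the hypothesis hT6 of `MonicDescent.descends_of_pieces` (p488513).  Nothing here is a statement of any manuscript.]

For a position `(B₀, B₁)` over `k[[u₁,u₂]]` the singular slices `S = y² + T₁ y + T₀` offered by the Refuter in the clause `PointClause` of the
descent game (spelled as in `won_monic_of_pointBlowup`: `B_j ∘ chart(c) = s^{3−j} Bv_j`, `T_j = (s·Bv_j)|_{slice}`) are FORMALLY RE-PRESENTED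
(`MonicDescent.Represents`) by the label transports of `…MonicDescentLabels`:
(`X_pow_mul_blowTwo` / `X_pow_mul_divTwo` are imported from res-L1-w43-lead-1's `…SliceIdentifyTwo` / `…BridgeTools`, landed in parallel.)
* `represents_pointSlice_zero` — exceptional point `(c₀ : c₁)`, `c₀ ≠ 0`, slice `y′₀ = 0`: by `blowOneLabel (shearLabel (C (c₁/c₀)) B)`
  (for `c₁ = 0` this is `blowOneLabel B` by `shear_zero_eq`); scaling `θ = (u₁/c₀, c₀u₂, c₀y)`;
* `represents_pointSlice_one_of_eq_zero` — point `(0 : c₁)`, slice `y′₁ = 0`: by `blowTwoLabel B`; swap-scaling `θ = (u₂/c₁, c₁u₁, c₁y)`.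
The remaining presentation (`y′₁ = 0` at `c₀c₁ ≠ 0`, a Möbius change of chart) and the curve slices are in `…BridgeMobius`.
-/

set_option linter.dupNamespace false -- mandated namespace of this single-conjunct summit

noncomputable section

namespace Summit.ResolutionOfSingularities.ResolutionOfSingularities.Theorems

namespace MonicDescent

open MvPowerSeries Literature.RingTheory.TwoVariableSeries Literature.AlgebraicGeometry.Resolution

variable {k : Type} [Field k]

/-! ## The point blow-up, slice `y′₀ = 0` (exceptional point `(c₀ : c₁)`, `c₀ ≠ 0`) -/

/-- The scaling `τ = (u₁/c₀, c₀u₂)` composed with the restricted chart `(c₀s, s(c₁ + y′₁))` is `(u₁, u₁(u₂ + c₁/c₀))`. -/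
theorem scale_restrictedChart_point_zero (c : Fin 2 → k) (hc : c 0 ≠ 0) (B : MvPowerSeries (Fin 2) k) :
    subst ![C (c 0)⁻¹ * X 0, C (c 0) * X 1] (subst ![X 0 * C (c 0), X 0 * (C (c 1) + X 1)] B) =
      subst ![(X 0 : MvPowerSeries (Fin 2) k), X 0 * (X 1 + C (c 1 / c 0))] B := by
  have hR : HasSubst (![X 0 * C (c 0), X 0 * (C (c 1) + X 1)] : Fin 2 → MvPowerSeries (Fin 2) k) :=
    hasSubst_of_constantCoeff_zero (by intro i; fin_cases i <;> simp [constantCoeff_X])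
  have hs : HasSubst (![C (c 0)⁻¹ * X 0, C (c 0) * X 1] : Fin 2 → MvPowerSeries (Fin 2) k) :=
    hasSubst_of_constantCoeff_zero (by intro i; fin_cases i <;> simp [constantCoeff_X])
  refine (subst_comp_subst_apply hR hs B).trans ?_
  congr 1
  funext i
  fin_cases i
  · show subst ![C (c 0)⁻¹ * X 0, C (c 0) * X 1] (X 0 * C (c 0)) = X 0
    rw [subst_mul hs, subst_X hs, subst_C]
    show C (c 0)⁻¹ * X 0 * C (c 0) = X 0
    rw [mul_comm, ← mul_assoc, ← map_mul, mul_inv_cancel₀ hc, map_one, one_mul]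
  · show subst ![C (c 0)⁻¹ * X 0, C (c 0) * X 1] (X 0 * (C (c 1) + X 1)) = X 0 * (X 1 + C (c 1 / c 0))
    rw [subst_mul hs, subst_add hs, subst_X hs, subst_X hs, subst_C]
    show C (c 0)⁻¹ * X 0 * (C (c 1) + C (c 0) * X 1) = X 0 * (X 1 + C (c 1 / c 0))
    have h1 : C (c 0)⁻¹ * C (c 0) = (1 : MvPowerSeries (Fin 2) k) := by rw [← map_mul, inv_mul_cancel₀ hc, map_one]
    have h2 : C (c 0)⁻¹ * C (c 1) = (C (c 1 / c 0) : MvPowerSeries (Fin 2) k) := by rw [← map_mul, div_eq_mul_inv, mul_comm]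
    rw [← h2]
    linear_combination (X 0 * X 1) * h1

/-- POINT SLICE `y′₀ = 0` AT `(c₀ : c₁)`, `c₀ ≠ 0`: the slice of the point blow-up of a position `(B₀, B₁)` is re-presented by
`blowOneLabel (shearLabel (C (c₁/c₀)) B)` (for `c₁ = 0`: by `blowOneLabel B`, `shear_zero_eq`). -/
theorem represents_pointSlice_zero {B₀ B₁ : MvPowerSeries (Fin 2) k} (hB : IsPosition B₀ B₁) (c : Fin 2 → k) (hc : c 0 ≠ 0)
    (Bv : Fin 2 → MvPowerSeries (Fin 3) k)
    (hBv : ∀ j : Fin 2, subst (CobordantChart.chart (fun _ : Fin 2 => 1) c) ((![B₀, B₁] : Fin 2 → MvPowerSeries (Fin 2) k) j) =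
      X 0 ^ (2 - (j : ℕ) + 1) * Bv j) :
    Represents (pos (TupleGame.slice 0 (X 0 * Bv 0)) (TupleGame.slice 0 (X 0 * Bv 1)))
      (blowOne 2 (shear (C (c 1 / c 0)) B₀)) (blowOne 1 (shear (C (c 1 / c 0)) B₁)) := by
  obtain ⟨hT₀, hT₁⟩ := pointSlice_data c 0 Bv hBv
  rw [restrictedChart_point_zero] at hT₀ hT₁
  obtain ⟨hB₀, hB₁⟩ := sum_ge_of_isPosition hB
  have hτ0 : ∀ i, constantCoeff ((![C (c 0)⁻¹ * X 0, C (c 0) * X 1] : Fin 2 → MvPowerSeries (Fin 2) k) i) = 0 := by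
    intro i; fin_cases i <;> simp [constantCoeff_X]
  refine represents_of_sliceData ![C (c 0)⁻¹ * X 0, C (c 0) * X 1] (C (c 0)) hτ0 ?_ ?_ ?_ hT₀ hT₁ ?_ ?_
  · -- det (diag (c₀⁻¹, c₀)) = 1
    have h00 : FormalCoordChange.linMat ![C (c 0)⁻¹ * X 0, C (c 0) * X 1] 0 0 = (c 0)⁻¹ := by
      simp [FormalCoordChange.linMat]
    have h01 : FormalCoordChange.linMat ![C (c 0)⁻¹ * X 0, C (c 0) * X 1] 0 1 = 0 := by
      simp [FormalCoordChange.linMat, coeff_index_single_X]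
    have h10 : FormalCoordChange.linMat ![C (c 0)⁻¹ * X 0, C (c 0) * X 1] 1 0 = 0 := by
      simp [FormalCoordChange.linMat, coeff_index_single_X]
    have h11 : FormalCoordChange.linMat ![C (c 0)⁻¹ * X 0, C (c 0) * X 1] 1 1 = c 0 := by
      simp [FormalCoordChange.linMat]
    rw [Matrix.det_fin_two, h00, h01, h10, h11, inv_mul_cancel₀ hc, zero_mul, sub_zero]
    exact isUnit_one
  · show C (c 0)⁻¹ * X 0 ≠ 0
    exact mul_ne_zero (by rw [Ne, map_eq_zero_iff _ C_injective]; exact inv_ne_zero hc) (X_ne_zero' _)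
  · rwa [constantCoeff_C]
  · rw [scale_restrictedChart_point_zero c hc, ← X_pow_mul_blowOne_shear_C 2 _ B₀ hB₀]
    show X 0 ^ 2 * _ = (C (c 0)⁻¹ * X 0) ^ 2 * (C (c 0) ^ 2 * _)
    have h1 : C (c 0)⁻¹ * C (c 0) = (1 : MvPowerSeries (Fin 2) k) := by rw [← map_mul, inv_mul_cancel₀ hc, map_one]
    linear_combination (-(C (c 0)⁻¹ * C (c 0) + 1) * X 0 ^ 2 * blowOne 2 (shear (C (c 1 / c 0)) B₀)) * h1
  · rw [scale_restrictedChart_point_zero c hc, ← X_pow_mul_blowOne_shear_C 1 _ B₁ hB₁, pow_one]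
    show X 0 * _ = C (c 0)⁻¹ * X 0 * (C (c 0) * _)
    have h1 : C (c 0)⁻¹ * C (c 0) = (1 : MvPowerSeries (Fin 2) k) := by rw [← map_mul, inv_mul_cancel₀ hc, map_one]
    linear_combination (-(X 0 * blowOne 1 (shear (C (c 1 / c 0)) B₁))) * h1

/-! ## The point blow-up, slice `y′₁ = 0` at `(0 : c₁)` -/

/-- The swap-scaling `τ = (u₂/c₁, c₁u₁)` composed with the restricted chart `(s·y′₀, c₁s)` is `(u₁u₂, u₂)`. -/
theorem scale_restrictedChart_point_one_of_eq_zero (c : Fin 2 → k) (hc0 : c 0 = 0) (hc : c 1 ≠ 0) (B : MvPowerSeries (Fin 2) k) :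
    subst ![C (c 1)⁻¹ * X 1, C (c 1) * X 0] (subst ![X 0 * (C (c 0) + X 1), X 0 * C (c 1)] B) =
      subst ![(X 0 * X 1 : MvPowerSeries (Fin 2) k), X 1] B := by
  have hR : HasSubst (![X 0 * (C (c 0) + X 1), X 0 * C (c 1)] : Fin 2 → MvPowerSeries (Fin 2) k) :=
    hasSubst_of_constantCoeff_zero (by intro i; fin_cases i <;> simp [constantCoeff_X])
  have hs : HasSubst (![C (c 1)⁻¹ * X 1, C (c 1) * X 0] : Fin 2 → MvPowerSeries (Fin 2) k) :=
    hasSubst_of_constantCoeff_zero (by intro i; fin_cases i <;> simp [constantCoeff_X])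
  refine (subst_comp_subst_apply hR hs B).trans ?_
  congr 1
  funext i
  fin_cases i
  · show subst ![C (c 1)⁻¹ * X 1, C (c 1) * X 0] (X 0 * (C (c 0) + X 1)) = X 0 * X 1
    rw [subst_mul hs, subst_add hs, subst_X hs, subst_X hs, subst_C, hc0, map_zero, zero_add]
    show C (c 1)⁻¹ * X 1 * (C (c 1) * X 0) = X 0 * X 1
    have h1 : C (c 1)⁻¹ * C (c 1) = (1 : MvPowerSeries (Fin 2) k) := by rw [← map_mul, inv_mul_cancel₀ hc, map_one]
    linear_combination (X 0 * X 1) * h1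
  · show subst ![C (c 1)⁻¹ * X 1, C (c 1) * X 0] (X 0 * C (c 1)) = X 1
    rw [subst_mul hs, subst_X hs, subst_C]
    show C (c 1)⁻¹ * X 1 * C (c 1) = X 1
    rw [mul_comm, ← mul_assoc, ← map_mul, mul_inv_cancel₀ hc, map_one, one_mul]

/-- POINT SLICE `y′₁ = 0` AT `(0 : c₁)`: the slice is re-presented by `blowTwoLabel B`. -/
theorem represents_pointSlice_one_of_eq_zero {B₀ B₁ : MvPowerSeries (Fin 2) k} (hB : IsPosition B₀ B₁) (c : Fin 2 → k)
    (hc0 : c 0 = 0) (hc : c 1 ≠ 0) (Bv : Fin 2 → MvPowerSeries (Fin 3) k)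
    (hBv : ∀ j : Fin 2, subst (CobordantChart.chart (fun _ : Fin 2 => 1) c) ((![B₀, B₁] : Fin 2 → MvPowerSeries (Fin 2) k) j) =
      X 0 ^ (2 - (j : ℕ) + 1) * Bv j) :
    Represents (pos (TupleGame.slice 1 (X 0 * Bv 0)) (TupleGame.slice 1 (X 0 * Bv 1))) (blowTwo 2 B₀) (blowTwo 1 B₁) := by
  obtain ⟨hT₀, hT₁⟩ := pointSlice_data c 1 Bv hBv
  rw [restrictedChart_point_one] at hT₀ hT₁
  obtain ⟨hB₀, hB₁⟩ := sum_ge_of_isPosition hB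
  have hτ0 : ∀ i, constantCoeff ((![C (c 1)⁻¹ * X 1, C (c 1) * X 0] : Fin 2 → MvPowerSeries (Fin 2) k) i) = 0 := by
    intro i; fin_cases i <;> simp [constantCoeff_X]
  refine represents_of_sliceData ![C (c 1)⁻¹ * X 1, C (c 1) * X 0] (C (c 1)) hτ0 ?_ ?_ ?_ hT₀ hT₁ ?_ ?_
  · have h00 : FormalCoordChange.linMat ![C (c 1)⁻¹ * X 1, C (c 1) * X 0] 0 0 = 0 := by
      simp [FormalCoordChange.linMat, coeff_index_single_X]
    have h01 : FormalCoordChange.linMat ![C (c 1)⁻¹ * X 1, C (c 1) * X 0] 0 1 = (c 1)⁻¹ := by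
      simp [FormalCoordChange.linMat]
    have h10 : FormalCoordChange.linMat ![C (c 1)⁻¹ * X 1, C (c 1) * X 0] 1 0 = c 1 := by
      simp [FormalCoordChange.linMat]
    have h11 : FormalCoordChange.linMat ![C (c 1)⁻¹ * X 1, C (c 1) * X 0] 1 1 = 0 := by
      simp [FormalCoordChange.linMat, coeff_index_single_X]
    rw [Matrix.det_fin_two, h00, h01, h10, h11, inv_mul_cancel₀ hc, zero_mul, zero_sub]
    exact isUnit_one.neg
  · show C (c 1)⁻¹ * X 1 ≠ 0
    exact mul_ne_zero (by rw [Ne, map_eq_zero_iff _ C_injective]; exact inv_ne_zero hc) (X_ne_zero' _)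
  · rwa [constantCoeff_C]
  · rw [scale_restrictedChart_point_one_of_eq_zero c hc0 hc, ← X_pow_mul_blowTwo 2 B₀ hB₀]
    show X 1 ^ 2 * _ = (C (c 1)⁻¹ * X 1) ^ 2 * (C (c 1) ^ 2 * _)
    have h1 : C (c 1)⁻¹ * C (c 1) = (1 : MvPowerSeries (Fin 2) k) := by rw [← map_mul, inv_mul_cancel₀ hc, map_one]
    linear_combination (-(C (c 1)⁻¹ * C (c 1) + 1) * X 1 ^ 2 * blowTwo 2 B₀) * h1
  · rw [scale_restrictedChart_point_one_of_eq_zero c hc0 hc, ← X_pow_mul_blowTwo 1 B₁ hB₁, pow_one]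
    show X 1 * _ = C (c 1)⁻¹ * X 1 * (C (c 1) * _)
    have h1 : C (c 1)⁻¹ * C (c 1) = (1 : MvPowerSeries (Fin 2) k) := by rw [← map_mul, inv_mul_cancel₀ hc, map_one]
    linear_combination (-(X 1 * blowTwo 1 B₁)) * h1


end MonicDescent

end Summit.ResolutionOfSingularities.ResolutionOfSingularities.Theorems

end
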